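import Summits.NavierStokesRegularity.NavierStokesRegularity.Theorems.PalasekTowerBreakdownHeredityFromTwoSterile

/-!
# NavierStokesRegularity — route `PalasekTowerBreakdown`: an UNFORCED AXISYMMETRIC SWIRL-FREE design
# carries registered stages only up to a FINITE level, and is never a realisation — any rates, any
# viscosity, any margins (unconditional; Ladyzhenskaya / Ukhovskii–Yudovich in the tree)

Supports `stmt-NavierStokesRegularity-19250` (`PalasekTowerBreakdown.HeredityFromTwo`); fourth file of
the series `…HeredityFromTwoRung` (p445539) / `…Global` (p446478) / `…Sterile` (p446857). Cell
`ns-blowup`, seat `ns-palasek-19250-p1` (g0). LABEL: E–C typing + kernel bookkeeping (theorems only;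
no definition; NO named fact; standard axioms). WHAT THIS IS NOT: not Navier–Stokes news — the
global regularity of axisymmetric swirl-free flows is classical (1968) and DISCHARGED in the tree
(`Literature.Analysis.FluidPDE.axisymmetric_no_swirl_global_regularity_holds`); nothing here bears on
flows with swirl or with a force, i.e. on the designs the route actually intends.

The previous file needed the child crux to empty the sterile unforced class at the generic levels.
WITHOUT any crux: for every viscosity `ν > 0`, rates `R`, margins `m` and schedule `S` whose force
vanishes on `[0, ∞)` and whose datum is axisymmetric without swirl,

* **`palasekTowerBreakdown_unforced_noSwirl_tower_finite`** — `∃ K, ∀ k ≥ K, IsEmpty (Stage ν R S m k)`: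
  the registered tower of `S` is FINITE (the design's global classical solution is bounded on the
  compact box `[0, S.T] × B̄(0, S.radius)`, every registered stage IS that solution on its slab by
  Tao's forced uniqueness, and the floors `c₁ Y_k → ∞` are read inside the box);
* `palasekTowerBreakdown_unforced_noSwirl_not_all_levels` — so `S` does not carry a stage at every
  level: the one-design door `navierStokesBreakdownR3_of_nonempty_stages` is SHUT on this class;
* **`palasekTowerBreakdown_realisation_not_unforced_noSwirl`** — no `Realisation ν R` (the E–C
  endpoint object, `PalasekStep2`) has a force vanishing on `[0, ∞)` and an axisymmetric swirl-free
  datum;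
* `palasekTowerBreakdown_exists_top_level_of_unforced_noSwirl_stage` — a sterile unforced design
  carrying SOME registered stage has a TOP level `k*` (a stage at `k*`, none at `k* + 1`): for the
  route's register (wide rates, `ν = 1`, `routeG`, pinned rigid quiet) such a design REFUTES
  `HeredityAt k*` (`palasekTowerBreakdown_not_heredityAt_top_of_unforced_noSwirl_stage`), hence — if
  it reaches level `1` — refutes the parent and ONE of the two children
  (`palasekTowerBreakdown_not_atOne_or_not_fromTwo_of_unforced_noSwirl_stage_one`). Which child
  depends on WHERE the finite tower stops (`k* = 1`: 19249; `k* ≥ 2`: 19250) — a quantitative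
  question this file does not touch. No such design with a level-`≥ 1` stage is known or constructed.

References: P. G. Lemarié-Rieusset, *The Navier–Stokes Problem in the 21st Century* (CRC 2016), Thm. 10.4
[cite: LemarieRieusset2016, Thm 10.4 (p. 285)]; T. Tao, Anal. PDE 6 (2013), Cor. 11.4
[cite: Tao2011, Cor. 11.4]; S. Palasek, arXiv:2605.13827 §4 [cite: Palasek2026ElementaryModel, §4].
-/

-- `Summit.<Summit>.<Problem>` is the tree's mandated summit-side namespace (CONVENTIONS §2); for this
-- single-conjunct summit the two coincide, so the duplicate is deliberate.
set_option linter.dupNamespace false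

noncomputable section

namespace Summit.NavierStokesRegularity.NavierStokesRegularity.Theorems

open Set MeasureTheory Filter Topology Function
open scoped ENNReal ContDiff
open Summit.NavierStokesRegularity.NavierStokesRegularity.Theses
open Summit.NavierStokesRegularity.FluidComputer.PalasekTowerClayBridge
open Literature.Analysis.FluidPDE

section AnyRates

variable {ν : ℝ} {R : TowerRates} {S : Schedule R} {m : Margins R}

/-- **A registered stage IS the design's flow on its slab** (any viscosity `ν > 0`, rates, margins):
a stage `s` of `S` at level `k` agrees in velocity on `[0, τ k]` with ANY classical finite-energy
solution of `S`'s forced Cauchy problem on a closed slab `[0, T']`, `τ k ≤ T'` (Tao's forced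
uniqueness, a theorem of the tree). General-rates form of
`palasekTowerBreakdown_stage_velocity_eq_solution`. [cite: Tao2011, Cor. 11.4] -/
theorem palasekTowerBreakdown_stage_velocity_eq_solution_rates (hν : 0 < ν) {k : ℕ}
    (s : Stage ν R S m k) {T' : ℝ} (hT' : S.τ k ≤ T')
    {U : ℝ → EuclideanSpace ℝ (Fin 3) → EuclideanSpace ℝ (Fin 3)}
    {P : ℝ → EuclideanSpace ℝ (Fin 3) → ℝ} (hU : IsClassicalNSSolutionOn (Icc 0 T') ν S.f U P)
    (hU0 : U 0 = S.u₀) (hUE : ∃ C : ℝ≥0∞, C < ⊤ ∧ ∀ t ∈ Icc 0 T', ∫⁻ x, ‖U t x‖ₑ ^ 2 ≤ C) :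
    ∀ t ∈ Icc 0 (S.τ k), s.u t = U t := by
  have hUk : IsClassicalNSSolutionOn (Icc 0 (S.τ k)) ν S.f U P :=
    hU.mono (Icc_subset_Icc le_rfl hT') (uniqueDiffOn_Icc (S.τ_pos k))
  have hUEk : ∃ C : ℝ≥0∞, C < ⊤ ∧ ∀ t ∈ Icc 0 (S.τ k), ∫⁻ x, ‖U t x‖ₑ ^ 2 ≤ C := by
    obtain ⟨C, hC, hb⟩ := hUE
    exact ⟨C, hC, fun t ht => hb t ⟨ht.1, ht.2.trans hT'⟩⟩
  exact tao_unconditional_uniqueness_velocity_forced_holds ν (S.τ k) hν (S.τ_pos k) S.u₀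
    s.memLp_datum.1 s.memLp_datum.2 S.f S.force_smooth S.force_decay s.u U s.p P s.classical hUk
    s.initial hU0 s.energy hUEk

/-- A classical velocity field on a closed slab `[0, T']` (any viscosity, any force) is bounded on
the box `[0, T'] × B̄(0, r)` (joint smoothness ⇒ continuity on a compact set). General form of
`palasekTowerBreakdown_solution_bounded_on_ball`. [folklore] -/
theorem palasekTowerBreakdown_solution_bounded_on_ball_visc {T' r : ℝ}
    {f U : ℝ → EuclideanSpace ℝ (Fin 3) → EuclideanSpace ℝ (Fin 3)}
    {P : ℝ → EuclideanSpace ℝ (Fin 3) → ℝ} (hU : IsClassicalNSSolutionOn (Icc 0 T') ν f U P) :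
    ∃ M : ℝ, ∀ t ∈ Icc 0 T', ∀ x : EuclideanSpace ℝ (Fin 3), ‖x‖ ≤ r → ‖U t x‖ ≤ M := by
  have hK : IsCompact (Icc (0 : ℝ) T' ×ˢ Metric.closedBall (0 : EuclideanSpace ℝ (Fin 3)) r) :=
    isCompact_Icc.prod (isCompact_closedBall _ _)
  have hc : ContinuousOn (uncurry U)
      (Icc (0 : ℝ) T' ×ˢ Metric.closedBall (0 : EuclideanSpace ℝ (Fin 3)) r) :=
    hU.smooth_velocity.continuousOn.mono (prod_mono le_rfl (subset_univ _))
  obtain ⟨M, hM⟩ := hK.exists_bound_of_continuousOn hc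
  refine ⟨M, fun t ht x hx => ?_⟩
  have hmem : (t, x) ∈ Icc (0 : ℝ) T' ×ˢ Metric.closedBall (0 : EuclideanSpace ℝ (Fin 3)) r :=
    mk_mem_prod ht (by simpa [Metric.mem_closedBall, dist_zero_right] using hx)
  exact hM (t, x) hmem

/-- **An unforced axisymmetric swirl-free design that carries any stage has a GLOBAL classical
finite-energy solution on every closed slab** (any viscosity `ν > 0`, rates, margins): the tree's
discharged Ladyzhenskaya / Ukhovskii–Yudovich theorem fed with the Clay datum `S.u₀` (smooth and
divergence free as the slice `t = 0` of the stage), the zero force relabelled as `S.f`. General-rates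
form of `palasekTowerBreakdown_exists_global_solution_of_unforced_noSwirl`.
[cite: LemarieRieusset2016, Thm 10.4 (p. 285)] -/
theorem palasekTowerBreakdown_exists_global_solution_of_unforced_noSwirl_rates (hν : 0 < ν) {k : ℕ}
    (s : Stage ν R S m k) (hf : ∀ t, 0 ≤ t → ∀ x, S.f t x = 0) (h0A : IsAxisymmetric S.u₀)
    (h0S : HasNoSwirl S.u₀) {T' : ℝ} (hT' : 0 < T') :
    ∃ (U : ℝ → EuclideanSpace ℝ (Fin 3) → EuclideanSpace ℝ (Fin 3))
      (P : ℝ → EuclideanSpace ℝ (Fin 3) → ℝ),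
      IsClassicalNSSolutionOn (Icc 0 T') ν S.f U P ∧ U 0 = S.u₀ ∧
      (∃ C : ℝ≥0∞, C < ⊤ ∧ ∀ t ∈ Icc 0 T', ∫⁻ x, ‖U t x‖ₑ ^ 2 ≤ C) := by
  have hsmooth : ContDiff ℝ ∞ S.u₀ := s.contDiff_datum
  have hdiv : VectorCalculus.IsDivFree S.u₀ := by
    rw [← s.initial]
    exact s.classical.divFree 0 ⟨le_rfl, (S.τ_pos k).le⟩
  obtain ⟨U, P, hcl, hU0, ⟨C, hC, hCb⟩, -⟩ :=
    axisymmetric_no_swirl_global_regularity_holds ν hν S.u₀ hsmooth hdiv S.datum_decay h0A h0S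
  refine ⟨U, P, ?_, hU0, ⟨C, hC, fun t ht => hCb t ht.1⟩⟩
  exact (hcl.mono Icc_subset_Ici_self (uniqueDiffOn_Icc hT')).congr_force
    fun t ht x => (hf t ht.1 x).symm

/-- **THE REGISTERED TOWER OF AN UNFORCED AXISYMMETRIC SWIRL-FREE DESIGN IS FINITE** (any
viscosity `ν > 0`, rates `R`, margins `m`; no crux, no named fact): if `S.f ≡ 0` on `[0, ∞)` and
`S.u₀` is axisymmetric without swirl, then `∃ K, ∀ k ≥ K, IsEmpty (Stage ν R S m k)`. Proof: if `S`
carries a stage at all, its datum is smooth and divergence free, so the tree's Ladyzhenskaya /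
Ukhovskii–Yudovich theorem gives a global classical finite-energy solution `U`; `U` is bounded by some
`M` on the compact box `[0, S.T] × B̄(0, S.radius)`; every registered stage of `S` equals `U` on its
slab (forced uniqueness) and reads a speed `≥ c₁ Y_k` in the box at `τ_k < S.T`; `c₁ Y_k → ∞`.
[cite: LemarieRieusset2016, Thm 10.4 (p. 285); Tao2011, Cor. 11.4] -/
theorem palasekTowerBreakdown_unforced_noSwirl_tower_finite (hν : 0 < ν)
    (hf : ∀ t, 0 ≤ t → ∀ x, S.f t x = 0) (h0A : IsAxisymmetric S.u₀) (h0S : HasNoSwirl S.u₀) :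
    ∃ K : ℕ, ∀ k : ℕ, K ≤ k → IsEmpty (Stage ν R S m k) := by
  by_cases hex : ∃ k, Nonempty (Stage ν R S m k)
  · obtain ⟨k₁, ⟨s₁⟩⟩ := hex
    obtain ⟨U, P, hU, hU0, hUE⟩ :=
      palasekTowerBreakdown_exists_global_solution_of_unforced_noSwirl_rates hν s₁ hf h0A h0S S.T_pos
    obtain ⟨M, hM⟩ := palasekTowerBreakdown_solution_bounded_on_ball_visc (r := S.radius) hU
    have hev : ∀ᶠ k in atTop, M < S.c₁ * R.Y k :=
      ((R.tendsto_Y_atTop.const_mul_atTop S.c₁_pos).eventually_gt_atTop M)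
    obtain ⟨K, hK⟩ := eventually_atTop.1 hev
    refine ⟨K, fun k hk => ⟨fun s => ?_⟩⟩
    obtain ⟨x, hx, hfl⟩ := s.floor k le_rfl
    have hτ : S.τ k ≤ S.T := (S.τ_lt_T k).le
    have heq : s.u (S.τ k) = U (S.τ k) :=
      palasekTowerBreakdown_stage_velocity_eq_solution_rates hν s hτ hU hU0 hUE (S.τ k)
        ⟨(S.τ_pos k).le, le_rfl⟩
    have hb := hM (S.τ k) ⟨(S.τ_pos k).le, hτ⟩ x hx
    rw [← heq] at hb
    linarith [hK k hk]
  · push Not at hex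
    exact ⟨0, fun k _ => hex k⟩

/-- **No unforced axisymmetric swirl-free design carries a registered stage at every level** — the
one-design door `navierStokesBreakdownR3_of_nonempty_stages` is shut on this class.
[cite: LemarieRieusset2016, Thm 10.4 (p. 285)] -/
theorem palasekTowerBreakdown_unforced_noSwirl_not_all_levels (hν : 0 < ν)
    (hf : ∀ t, 0 ≤ t → ∀ x, S.f t x = 0) (h0A : IsAxisymmetric S.u₀) (h0S : HasNoSwirl S.u₀) :
    ¬ ∀ k : ℕ, Nonempty (Stage ν R S m k) := by
  obtain ⟨K, hK⟩ := palasekTowerBreakdown_unforced_noSwirl_tower_finite (m := m) hν hf h0A h0S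
  exact fun h => (hK K le_rfl).false (h K).some

/-- **A sterile unforced design that carries SOME registered stage has a TOP level**: a stage at
`k*` and none at `k* + 1`. [folklore] -/
theorem palasekTowerBreakdown_exists_top_level_of_unforced_noSwirl_stage (hν : 0 < ν)
    (hf : ∀ t, 0 ≤ t → ∀ x, S.f t x = 0) (h0A : IsAxisymmetric S.u₀) (h0S : HasNoSwirl S.u₀)
    {k₀ : ℕ} (s : Stage ν R S m k₀) :
    ∃ kstar : ℕ, k₀ ≤ kstar ∧ Nonempty (Stage ν R S m kstar) ∧ IsEmpty (Stage ν R S m (kstar + 1)) := by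
  obtain ⟨K, hK⟩ := palasekTowerBreakdown_unforced_noSwirl_tower_finite (m := m) hν hf h0A h0S
  by_contra hcon
  push Not at hcon
  -- climbing: every level `k₀ + n` is inhabited
  have hall : ∀ n : ℕ, Nonempty (Stage ν R S m (k₀ + n)) := by
    intro n
    induction n with
    | zero => exact ⟨s⟩
    | succ n ih => exact hcon (k₀ + n) (Nat.le_add_right k₀ n) ih
  have hKle : K ≤ k₀ + K := Nat.le_add_left K k₀
  exact (hK (k₀ + K) hKle).false (hall K).some

end AnyRates

/-! ## The E–C endpoint object and the route's register -/

/-- **No realisation of the tower is unforced with an axisymmetric swirl-free datum** (any rates,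
any viscosity `ν > 0`): a `Realisation ν R` whose force vanishes on `[0, ∞)` and whose datum `u 0`
is axisymmetric without swirl does not exist — the tree's global classical solution from `u 0`
coincides with the realisation on `[0, T)` (forced uniqueness on each `[0, t]`) and is continuous on
the box `[0, T] × B̄(0, radius)`, which the floors forbid (`Realisation.false_of_continuousOn_box`).
So `PalasekStep2` cannot be met inside the sterile unforced class. [cite: LemarieRieusset2016, Thm 10.4 (p. 285); Tao2011, Cor. 11.4] -/
theorem palasekTowerBreakdown_realisation_not_unforced_noSwirl {ν : ℝ} {R : TowerRates}
    (hν : 0 < ν) (W : Realisation ν R) (hf : ∀ t, 0 ≤ t → ∀ x, W.f t x = 0)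
    (h0A : IsAxisymmetric (W.u 0)) (h0S : HasNoSwirl (W.u 0)) : False := by
  obtain ⟨U, P, hcl, hU0, ⟨C, hC, hCb⟩, -⟩ :=
    axisymmetric_no_swirl_global_regularity_holds ν hν (W.u 0) W.contDiff_datum
      (W.classical.divFree 0 ⟨le_rfl, W.T_pos⟩) W.datum_decay h0A h0S
  have hclf : IsClassicalNSSolutionOn (Ici 0) ν W.f U P :=
    hcl.congr_force fun t ht x => (hf t ht x).symm
  -- agreement on `[0, T)`
  have heq : ∀ t ∈ Ico 0 W.T, U t = W.u t := by
    intro t ht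
    rcases ht.1.eq_or_lt with h0 | h0
    · rw [← h0]; exact hU0
    · have hUt : IsClassicalNSSolutionOn (Icc 0 t) ν W.f U P :=
        hclf.mono (fun r hr => hr.1) (uniqueDiffOn_Icc h0)
      have hWt : IsClassicalNSSolutionOn (Icc 0 t) ν W.f W.u W.p := W.classical_Icc h0 ht.2
      exact tao_unconditional_uniqueness_velocity_forced_holds ν t hν h0 (W.u 0) W.memLp_datum.1
        W.memLp_datum.2 W.f W.force_smooth W.force_decay U W.u P W.p hUt hWt hU0 rfl
        ⟨C, hC, fun r hr => hCb r hr.1⟩ (W.energy t ht.2) t ⟨ht.1, le_rfl⟩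
  refine W.false_of_continuousOn_box (v := U) ?_ heq
  exact hclf.smooth_velocity.continuousOn.mono (prod_mono (fun r hr => hr.1) (subset_univ _))

section Register

variable {S : Schedule TowerRates.wide}

/-- **A sterile unforced design of the route's register that carries a registered stage refutes
heredity at its TOP level**: for a pinned (`Λ = 8`, `θ = 6/5`) rigid quiet wide schedule with
`S.f ≡ 0` on `[0, ∞)` and axisymmetric swirl-free datum, carrying a registered stage at level `k₀`,
there is `k* ≥ k₀` with `¬ HeredityAt k*`. No such design with `k₀ ≥ 1` is known.
[cite: LemarieRieusset2016, Thm 10.4 (p. 285); Palasek2026ElementaryModel, §4] -/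
theorem palasekTowerBreakdown_not_heredityAt_top_of_unforced_noSwirl_stage (hP : S.Pins 8 (6 / 5))
    (hR : S.Rigid) (hQ : S.Quiet) (hf : ∀ t, 0 ≤ t → ∀ x, S.f t x = 0) (h0A : IsAxisymmetric S.u₀)
    (h0S : HasNoSwirl S.u₀) {k₀ : ℕ} (s : Stage 1 TowerRates.wide S (Margins.routeG TowerRates.wide) k₀) :
    ∃ kstar : ℕ, k₀ ≤ kstar ∧ ¬ HeredityAt kstar := by
  obtain ⟨kstar, hk, ⟨s'⟩, hE⟩ :=
    palasekTowerBreakdown_exists_top_level_of_unforced_noSwirl_stage one_pos hf h0A h0S s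
  refine ⟨kstar, hk, fun hH => ?_⟩
  obtain ⟨s'', -⟩ := hH S hP hR hQ s'
  exact hE.false s''

/-- **A sterile unforced RungG-1 exhibit refutes the parent and ONE of the two children**: such a
design with a registered LEVEL-1 stage gives `¬ HeredityAtOne ∨ ¬ HeredityFromTwo` (its finite tower
stops at level `1` — refuting 19249 — or at some level `≥ 2` — refuting 19250); the parent
`EpisodeInduction` fails either way (`palasekTowerBreakdown_not_episodeInduction_of_unforced_noSwirl_stage`).
Which child falls is a QUANTITATIVE question (planner g18 STATUS l.3948), untouched here; no such
exhibit is known. [cite: LemarieRieusset2016, Thm 10.4 (p. 285); Palasek2026ElementaryModel, §4] -/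
theorem palasekTowerBreakdown_not_atOne_or_not_fromTwo_of_unforced_noSwirl_stage_one
    (hP : S.Pins 8 (6 / 5)) (hR : S.Rigid) (hQ : S.Quiet) (hf : ∀ t, 0 ≤ t → ∀ x, S.f t x = 0)
    (h0A : IsAxisymmetric S.u₀) (h0S : HasNoSwirl S.u₀)
    (s : Stage 1 TowerRates.wide S (Margins.routeG TowerRates.wide) 1) :
    ¬ PalasekTowerBreakdown.HeredityAtOne ∨ ¬ PalasekTowerBreakdown.HeredityFromTwo := by
  obtain ⟨kstar, hk, hH⟩ :=
    palasekTowerBreakdown_not_heredityAt_top_of_unforced_noSwirl_stage hP hR hQ hf h0A h0S s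
  rcases hk.eq_or_lt with h1 | h2
  · exact Or.inl fun h => hH (h1 ▸ heredityAtOne_iff.1 h)
  · exact Or.inr fun h => hH (HeredityFrom.heredityAt h h2)

end Register

end Summit.NavierStokesRegularity.NavierStokesRegularity.Theorems

end
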